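import Summits.CriticalPhenomena.Ising3D.Control2DVertexData
import Mathlib.Tactic
import HarnessLib

/-!
# Non-vacuity of the 2D control's hypothesis classes WITH a stress tensor: consequences of the free-boson
witness (cell `pub-ising3x`, seat controls-1 gen 36; step 7 of 7 — CONTROL-ONLY)

HONEST FRAMING: lottery ticket; floor = tightest certified 3D Ising CFT bounds; no exact-solution
claim without a proof. CONTROL-ONLY (`d = 2`, `Δ_σ = s`; the witness is the free boson at `c = 1`,
NOT the 2D Ising CFT); nothing numerical is asserted here.

`Control2DNonVacuity` inhabits `IsUnitary ∧ SatisfiesCrossing s` with the generalised free field (scalar gap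
exactly `2s`, i.e. `1/4` at the control's column; NO `(2,2)` quasi-primary). With `vertexData2D s`
(`Control2DVertexData`: scalar gap `min(4s,2)`, a stress tensor with `p_T = s²/2`) this file records:

* every column `s > 0`: `crossingData_nonvacuous_stress`; **`not_gapExcluded_of_le_vertex`**
  (`¬ GapExcluded s U` for `U ≤ min(4s,2)`); **`opeBound_floor_vertex`** (`OpeBound s U P ∧ U ≤ min(4s,2) ⇒ s²/2 < P`);
* the control's column `s = 1/8`: **`not_gapExcluded_2d_half : ¬ GapExcluded (1/8) (1/2)`** (with
  `Control2DRecord.record_oneSided`'s `GapExcluded (1/8) (20001/20000)` the one-sided threshold lies in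
  `(1/2, 1.00005]`; the free field gave `(1/4, …]`); **`opeBound_floor_eighth`** (`OpeBound (1/8) U P`, `U ≤ 1/2`
  `⇒ 1/128 < P`) and `opeBound_class_nonvacuous_eighth` — the hypothesis class of the `OpeBound (1/8) (3/10) ·`
  item (scalar gap `≥ 3/10`, NOT inhabited by the free field) contains a datum with a genuine `(2,2)` primary
  of coefficient `1/128 = (1/8)²/(2·1)`, so no certificate of that kind reaches the `c = 1` Ward value;
* columns `s ≥ 1/4`: the `A2D′` classes `(G, δ) = (2, 1)` are inhabited (`vertexData2D_A2D`,
  `not_excludedAt_vertex`): every `BoxExcluded s 2 1 e₁ e₂` misses `4s`, every `TwoSided s 2 1 w ε_lo U` with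
  `w ≤ 4s` has `ε_lo < 4s < U`, every `CTwoSided s 2 1 e₁ e₂ c_lo c_hi` whose `ε`-box admits `4s` has
  `c_lo < 1 < c_hi` (`c = 1` inside every such certified interval); and for `s ≥ 1/2` the typed
  `TwoSided s 2 1 …` / `BoxExcluded s 2 1 …` are unsatisfiable resp. false (`twoSided_false_of_half_le`,
  `boxExcluded_false_of_half_le`) — a caveat on the typed class-1 statement away from the control's column,
  harmless at `s = 1/8` where `GapExcluded (1/8) (20001/20000)` forces a scalar below `G = 2`.

What is NOT witnessed: the `A2D′` classes AT `s = 1/8` (the free boson there has a spin-2 quasi-primary at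
`4s + 2 = 5/2 < 3`); their witness is the 2D Ising datum itself (Virasoro, `c = 1/2`), not in the tree.

References: Ph. Di Francesco, P. Mathieu, D. Sénéchal, Conformal Field Theory (Springer 1997), §9.1
[cite: DiFrancescoMathieuSenechal1997, §9.1]; R. Rattazzi, V. S. Rychkov, E. Tonni, A. Vichi, JHEP 12
(2008) 031, §5 [cite: RattazziEtAl2008, §5]; A. A. Belavin, A. M. Polyakov, A. B. Zamolodchikov,
Nucl. Phys. B 241 (1984) 333, §3 [cite: BelavinPolyakovZamolodchikov1984, §3]. Tree: `GapExcluded`, `OpeBound`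
(`Control2DBootstrap`), `BoxExcluded`, `ExcludedAt`, `TwoSided` (`Control2DIsland`), `CTwoSided`
(`Control2DOpeTwoSided`), `vertexData2D` + lemmas (`Control2DVertexData`).
-/

namespace Summit.CriticalPhenomena.Ising3D.Control2D

open Finset Set
open Literature.MathematicalPhysics.QuantumFieldTheory.ConformalBootstrap3D

section Consequences

variable {s : ℝ}

/-! ### Consequences, every column `s > 0` -/

/-- **NON-VACUITY WITH A STRESS TENSOR.** For every `s > 0` there is a parity-symmetric unitary solution of
the 2D `⟨σσσσ⟩` sum rule at `Δ_σ = s` with scalar gap `min(4s, 2)`, spin-2 content in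
`{2} ∪ [2 + min(2,4s), ∞)` and total `(2,2)` coefficient `s²/2` (the free boson, `c = 1`). [cite: DiFrancescoMathieuSenechal1997, §9.1] -/
theorem crossingData_nonvacuous_stress (hs : 0 < s) :
    ∃ D : CrossingData, D.IsUnitary ∧ D.SatisfiesCrossing s ∧ D.HasScalarGap (min (4 * s) 2) ∧
      D.SpinTwoIn ({2} ∪ Ici (2 + min 2 (4 * s))) ∧ D.stressCoeff = s ^ 2 / 2 :=
  ⟨vertexData2D s, vertexData2D_isUnitary hs, vertexData2D_satisfiesCrossing hs,
    vertexData2D_hasScalarGap hs, vertexData2D_spinTwoIn s, vertexData2D_stressCoeff hs⟩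

/-- **No gap at or below `min(4Δ_σ, 2)` is excludable**: `¬ GapExcluded s U` for `U ≤ min(4s, 2)`.
[folklore] -/
theorem not_gapExcluded_of_le_vertex (hs : 0 < s) {U : ℝ} (hU : U ≤ min (4 * s) 2) :
    ¬ GapExcluded s U :=
  fun h => h (vertexData2D s) (vertexData2D_isUnitary hs) (vertexData2D_satisfiesCrossing hs)
    ((vertexData2D_hasScalarGap hs).mono hU)

/-- **Every certified OPE bound at the stress tensor exceeds the `c = 1` Ward value**:
`OpeBound s U P` with `U ≤ min(4s, 2)` forces `s²/2 < P`. [folklore] -/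
theorem opeBound_floor_vertex (hs : 0 < s) {U P : ℝ} (hU : U ≤ min (4 * s) 2) (h : OpeBound s U P) :
    s ^ 2 / 2 < P := by
  obtain ⟨hΔ, hsp, hp⟩ := vertexData2D_stressLabel s
  have := h (vertexData2D s) (vertexData2D_isUnitary hs) (vertexData2D_satisfiesCrossing hs)
    ((vertexData2D_hasScalarGap hs).mono hU) (Sum.inl vtxStressLabel) hΔ hsp
  rwa [hp] at this

/-! ### The control's column `s = 1/8` -/

/-- **`¬ GapExcluded (1/8) (1/2)`**: at the 2D Ising column the scalar gap `1/2 = 4Δ_σ` is inhabited (free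
boson), so the typed one-sided item's threshold lies above `1/2` (kernel; with
`Control2DRecord.record_oneSided`'s `GapExcluded (1/8) (20001/20000)` it is pinned in `(1/2, 1.00005]`).
[folklore] -/
theorem not_gapExcluded_2d_half : ¬ GapExcluded (1 / 8 : ℝ) (1 / 2) :=
  not_gapExcluded_of_le_vertex (by norm_num) (by norm_num)

/-- **The `OpeBound (1/8) U ·` class is inhabited by a datum WITH a `(2,2)` primary** (for `U ≤ 1/2`, e.g.
the control's `U = 3/10`): hence `OpeBound (1/8) U P → 1/128 < P` — no certificate of this kind can push
the bound to the `c = 1` Ward value `(1/8)²/2 = 1/128`. [folklore] -/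
theorem opeBound_floor_eighth {U P : ℝ} (hU : U ≤ 1 / 2) (h : OpeBound (1 / 8 : ℝ) U P) :
    (1 / 128 : ℝ) < P := by
  have hU' : U ≤ min (4 * (1 / 8 : ℝ)) 2 := by
    rw [show min (4 * (1 / 8 : ℝ)) 2 = 1 / 2 by norm_num]; exact hU
  have := opeBound_floor_vertex (s := 1 / 8) (by norm_num) hU' h
  norm_num at this
  exact this

/-- The hypothesis class of the control's `OpeBound (1/8) (3/10) ·` item, inhabited with a stress tensor of
coefficient `1/128`. [folklore] -/
theorem opeBound_class_nonvacuous_eighth :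
    ∃ D : CrossingData, D.IsUnitary ∧ D.SatisfiesCrossing (1 / 8 : ℝ) ∧ D.HasScalarGap (3 / 10) ∧
      ∃ i : D.ι, D.Δ i = 2 ∧ D.spin i = 2 ∧ D.p i = 1 / 128 := by
  refine ⟨vertexData2D (1 / 8), vertexData2D_isUnitary (by norm_num),
    vertexData2D_satisfiesCrossing (by norm_num),
    (vertexData2D_hasScalarGap (s := 1 / 8) (by norm_num)).mono (by norm_num), Sum.inl vtxStressLabel, ?_⟩
  obtain ⟨h1, h2, h3⟩ := vertexData2D_stressLabel (1 / 8 : ℝ)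
  exact ⟨h1, h2, by rw [h3]; norm_num⟩

/-! ### Columns `s ≥ 1/4`: the `A2D′` classes `(G, δ) = (2, 1)` are inhabited; `s ≥ 1/2`: a caveat -/

/-- For `s ≥ 1/4` the witness satisfies `A2D′` with `(G, δ) = (2, 1)`: scalars in `{4s} ∪ [2,∞)`, spin 2 in
`{2} ∪ [3, ∞)`. [folklore] -/
theorem vertexData2D_A2D (hs : 1 / 4 ≤ s) :
    (vertexData2D s).ScalarsIn ({4 * s} ∪ Ici 2) ∧ (vertexData2D s).SpinTwoIn ({2} ∪ Ici (2 + 1)) := by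
  have hs0 : 0 < s := by linarith
  refine ⟨vertexData2D_scalarsIn hs0, fun i hi => ?_⟩
  rcases vertexData2D_spinTwoIn s i hi with h | h
  · exact Or.inl h
  · right
    have h1 : (1 : ℝ) ≤ min 2 (4 * s) := le_min (by norm_num) (by linarith)
    have h2 : 2 + min 2 (4 * s) ≤ (vertexData2D s).Δ i := h
    show (2 : ℝ) + 1 ≤ (vertexData2D s).Δ i
    linarith

/-- **The location `x = 4s` is not excludable** under `A2D′` `(2,1)` for `s ≥ 1/4`. [folklore] -/
theorem not_excludedAt_vertex (hs : 1 / 4 ≤ s) : ¬ ExcludedAt s 2 1 (4 * s) := by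
  have hs0 : 0 < s := by linarith
  obtain ⟨hS, hT⟩ := vertexData2D_A2D hs
  exact fun h => h (vertexData2D s) (vertexData2D_isUnitary hs0) (vertexData2D_satisfiesCrossing hs0) hS hT

/-- **Every box certificate misses `4s`** (`s ≥ 1/4`): `BoxExcluded s 2 1 e₁ e₂ → 4s ∉ [e₁, e₂]`. [folklore] -/
theorem boxExcluded_misses_vertex (hs : 1 / 4 ≤ s) {e₁ e₂ : ℝ} (h : BoxExcluded s 2 1 e₁ e₂) :
    4 * s ∉ Icc e₁ e₂ :=
  fun hmem => not_excludedAt_vertex hs (h.excludedAt hmem)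

/-- **Every class-1 statement contains the free-boson point** (`s ≥ 1/4`): `TwoSided s 2 1 w ε_lo U` with
`w ≤ 4s` gives `ε_lo < 4s < U`. [folklore] -/
theorem twoSided_vertex (hs : 1 / 4 ≤ s) {w εlo U : ℝ} (h : TwoSided s 2 1 w εlo U) (hw : w ≤ 4 * s) :
    εlo < 4 * s ∧ 4 * s < U := by
  have hs0 : 0 < s := by linarith
  obtain ⟨hS, hT⟩ := vertexData2D_A2D hs
  exact h (vertexData2D s) (vertexData2D_isUnitary hs0) (vertexData2D_satisfiesCrossing hs0) hT (4 * s) hw hS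

/-- **`c = 1` lies inside every certified central-charge interval whose `ε`-box admits the free boson**
(`s ≥ 1/4`, `4s ∈ [e₁, e₂] ∪ [2, ∞)`): `CTwoSided s 2 1 e₁ e₂ c_lo c_hi → c_lo < 1 < c_hi` — the witness's
total `(2,2)` coefficient is `s²/(2·1)`. [cite: BelavinPolyakovZamolodchikov1984, §3] -/
theorem cTwoSided_vertex (hs : 1 / 4 ≤ s) {e₁ e₂ clo chi : ℝ} (h : CTwoSided s 2 1 e₁ e₂ clo chi)
    (hbox : 4 * s ∈ Icc e₁ e₂ ∪ Ici 2) : clo < 1 ∧ 1 < chi := by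
  have hs0 : 0 < s := by linarith
  obtain ⟨hS, hT⟩ := vertexData2D_A2D hs
  have hS' : (vertexData2D s).ScalarsIn (Icc e₁ e₂ ∪ Ici 2) := by
    intro i hi
    rcases hS i hi with h1 | h1
    · rw [Set.mem_singleton_iff] at h1; rw [h1]; exact hbox
    · exact Or.inr h1
  exact h (vertexData2D s) (vertexData2D_isUnitary hs0) (vertexData2D_satisfiesCrossing hs0) hS' hT 1 one_pos
    (by rw [vertexData2D_stressCoeff hs0]; ring)

/-- **Caveat on the typed class-1 statement away from the control's column**: for `s ≥ 1/2` the free boson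
has ALL its scalars at `Δ ≥ 2 = G`, so it satisfies `ScalarsIn ({x} ∪ [2,∞))` for EVERY location `x`, and
`TwoSided s 2 1 w ε_lo U` is false for all `w, ε_lo, U` (likewise every `BoxExcluded s 2 1 e₁ e₂`). At
`s = 1/8` this cannot happen: `GapExcluded (1/8) (20001/20000)` forces a scalar below `2`. [folklore] -/
theorem twoSided_false_of_half_le (hs : 1 / 2 ≤ s) (w εlo U : ℝ) : ¬ TwoSided s 2 1 w εlo U := by
  have hs0 : 0 < s := by linarith
  obtain ⟨hS, hT⟩ := vertexData2D_A2D (s := s) (by linarith)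
  have hSx : ∀ x : ℝ, (vertexData2D s).ScalarsIn ({x} ∪ Ici 2) := by
    intro x i hi
    rcases hS i hi with h1 | h1
    · rw [Set.mem_singleton_iff] at h1; right; rw [h1]; show (2 : ℝ) ≤ 4 * s; linarith
    · exact Or.inr h1
  intro h
  have := h (vertexData2D s) (vertexData2D_isUnitary hs0) (vertexData2D_satisfiesCrossing hs0) hT
    (max w U) (le_max_left _ _) (hSx _)
  linarith [le_max_right w U, this.2]

/-- For `s ≥ 1/2` every `BoxExcluded s 2 1 e₁ e₂` is false (the free boson has no sub-gap scalar at all).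
[folklore] -/
theorem boxExcluded_false_of_half_le (hs : 1 / 2 ≤ s) (e₁ e₂ : ℝ) : ¬ BoxExcluded s 2 1 e₁ e₂ := by
  have hs0 : 0 < s := by linarith
  obtain ⟨hS, hT⟩ := vertexData2D_A2D (s := s) (by linarith)
  have hS' : (vertexData2D s).ScalarsIn (Icc e₁ e₂ ∪ Ici 2) := by
    intro i hi
    rcases hS i hi with h1 | h1
    · rw [Set.mem_singleton_iff] at h1; right; rw [h1]; show (2 : ℝ) ≤ 4 * s; linarith
    · exact Or.inr h1
  exact fun h => h (vertexData2D s) (vertexData2D_isUnitary hs0) (vertexData2D_satisfiesCrossing hs0) hS' hT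

end Consequences

end Summit.CriticalPhenomena.Ising3D.Control2D
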